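import Mathlib
import HarnessLib
import HarnessLib.Audit
import Summits.Parity.Statement
import Literature.NumberTheory.Sieve.LinearEquationsInPrimes
import HarnessLib.Audit.Status.Attr

/-!
Route: LiouvilleOpening

DORMANT since 2026-08-24T09:56:16Z (reconciler: no traction for 6.7 d (last activity item-evidence-added at 2026-08-17T16:57:35Z); parked, not closed — `ledger route dormant route-Parity-LiouvilleOpening --off` to reactivate) — unstaffed, not closed; items shared with open routes are served there. `ledger route dormant <id> --off` reactivates.

# Route LiouvilleOpening — Liouville opening — complete multiplicativity turns the whole parity
content of prime pairs into the plain two-point Chowla sum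

It suffices to show X = PairLiouvilleLaw ∧ ChowlaNatural (landing on the target RelativePairs)
together with the declared residual
RelativePairsToGHL. Open EVERY von Mangoldt factor of a pair system Ψ = (ψ₁, ψ₂) (d = 1, size ≤ L,
convex K ⊆ [−N, N]) through the
LIOUVILLE function, not Möbius: Λ = μ⋆log and μ = λ⋆μ_sq give Λ(m) = λ(m)·L⋆(m), L⋆(m) = Σ_{k²∣m}
μ(k) Σ_{b∣m/k²} λ(b) log b, because
λ(m/bk²) = λ(m)λ(b) (complete multiplicativity — the identity μ(m/b) = μ(m)μ(b) that would be needed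
with Möbius is FALSE). Truncating
the smooth variable at B = N^{1/2+ε} splits the prime-pair sum EXACTLY as S_Ψ = MAIN + CORE with
CORE = Σ_n λ(ψ₁(n))λ(ψ₂(n))·W(ψ₁(n))W(ψ₂(n)),
W a divisor-sum weight of level B; MAIN is Bombieri–Vinogradov (a theorem of the tree), the balanced
window of CORE is Duke–Friedlander–
Iwaniec's bilinear Kloosterman-fractions bound (a theorem of the tree), and the rest of CORE is the
pair CHOWLA SEQUENCE in progressions.
Because the λ-SIGNED cofactor series converge (Σ_b λ(b) log b/b = −ζ(2), prime number theorem for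
λ), relative equidistribution of the
Chowla sequence (RelativeChowlaLevel) yields the PAIR LIOUVILLE LAW  S_Ψ − β_∞𝔖_Ψ = 𝔠_Ψ·Σ_{n∈K}
λ(ψ₁(n))λ(ψ₂(n)) + o((1+𝔖_Ψ)N)
with an explicit non-zero Euler-product constant 𝔠_Ψ: the entire parity content of Hardy–Littlewood
PAIRS is natural-density two-point
Chowla with o(1) precision — no log-power savings, no dilations, no bilinear Liouville sums.
Lean: `PairLiouvilleLaw ∧ ChowlaNatural ∧ RelativePairsToGHL`

## Assembly
Pure logic plus one ε/2-arithmetic lemma, sorry-free in Sketch.lean / glue.lean: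
relativePairs_of_law (PairLiouvilleLaw → ChowlaNatural →
RelativePairs: |S − M| ≤ |S − M − 𝔠C| + |𝔠||C| ≤ (ε/2)(1+|𝔖|)N + K_L(1+|𝔖|)·εN/(2(K_L+1))) and
`closes hLaw hCh hRes := hRes (relativePairs_of_law hLaw hCh)` — hypotheses = the three
cruxes PairLiouvilleLaw, ChowlaNatural, RelativePairsToGHL (crux-only), conclusion
`_root_.GeneralizedHardyLittlewood` by name; RelativeChowlaLevel
lies in the cone of closes through the support LawOfLevel. CONE REPAIR (rev 1): the route file
imports nothing beyond the gate defaults —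
the tree's proved fibration lemma `FibrationGlue.generalizedHardyLittlewood_of_dimOne : DimOne →
GeneralizedHardyLittlewood` is no longer cited by
`closes` (its module cone carries the unproved Green–Tao facts GreenTao2010_gowersUniformity /
GreenTao2010_transference through
Literature…LinearEquationsInPrimesNormalForm → …Transference, used by no decl here); it is folded
into the residual crux RelativePairsToGHL,
whose prover imports it in a Theorems file.

Rationale: WHY THIS LINE. Barrier inversion (operator C): Selberg/Bombieri/Polymath8b §8 force a parity input
not invariant under ω = 1−λ(n)λ(n+h); TrueComplexityBinary
and CircleMethodBinary force it to be Λ/λ-specific; LogarithmicAveraging forces natural density;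
every open route pays log-power savings in its
parity atom because Möbius-opened cores do not factor (NOTES "dilation harmonic loss"). The
Liouville opening is the one decomposition in which the
core FACTORS through c_Ψ(n) = λ(ψ₁(n))λ(ψ₂(n)) and the cofactor sums CONVERGE with their signs, so
the weakest conceivable parity statement —
Σ λ(ψ₁(n))λ(ψ₂(n)) = o(N), the natural-density form of Tao's two-point theorem (TaoFMP2016; natural
density is known for ODD orders,
TaoTeravainenDuke2019; rates HelfgottRadziwill2021, Pilatte2026) — is exactly sufficient, while
everything else is distributional:
Bombieri–Vinogradov for primes (tree, proved), DukeFriedlanderIwaniec1997 Thm 2 (tree, proved: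
`Literature.NumberTheory.LFunctions.DukeFriedlanderIwaniec1997_bilinearKloostermanFractions_holds`)
and a RELATIVE (mean-free) level of distribution for the Chowla sequence, which a biased i.i.d.
model passes (parity-neutral). Versus the
nearest route DeterminantMoebiusCores (same skeleton BV-main / DFI-centre / cores): its cores are
Λ♯-correlations along dilated progressions
with divisor-weighted level and (log N)^{−A} savings; here the core is re-cut by the λ-factorisation
into (mean) × 𝔠_Ψ + (relative fluctuation),
and the mean IS plain Chowla. Versus MurtyVatwani2017 (CE(θ<½): μ at shifted primes in progressions
with log² savings, one factor opened) and
the folklore "Chowla in progressions with log-power savings ⇒ twins": the law is identity-level with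
an explicit constant under a MEAN-FREE
hypothesis, and it is uniform over ALL pair systems (Goldbach (n, M−n), Sophie Germain (n, 2n+1),
shift-uniform pairs) — RelativePairs.
Imported areas: pretentious/multiplicative number theory (Chowla–Elliott technology) for the parity
crux; automorphic Kloosterman
technology (DFI, Bettin–Chandee, in tree) for the balanced window. Negatives index (3 statements)
untouched: no convolution moments, no
free window exponent, no pretentious-distance threshold.

RANKED CRUXES. #0 RelativePairs (target) — relative Dickson–Hardy–Littlewood for PAIRS: uniformly
over non-degenerate d = 1 systems of two forms with ‖Ψ‖_N ≤ L and convex K ⊆ [−N,N],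
|Σ_{n∈K}Λ(ψ₁(n))Λ(ψ₂(n)) − β_∞∏_pβ_p| ≤ ε(1 + |∏_pβ_p|)N. Derived in glue.lean from PairLiouvilleLaw
∧ ChowlaNatural (theorem relativePairs_of_law); contains every fixed pair system's Hardy–Littlewood
asymptotic (twins, Sophie Germain, Goldbach shapes) and is shift-uniform. (why it might fail:
shift-uniform, hence Siegel-complete (a zero of unbounded quality at conductor q ≤ LN doubles the
pair count at shift 2q, MatomakiMerikoski2023 Thm 1.3); contains binary Goldbach asymptotics for
every large even M.) [GreenTao2010, MatomakiMerikoski2023, HardyLittlewood1923]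
#2 PairLiouvilleLaw (crux) — PAIR LIOUVILLE LAW: for every L there is K_L with, uniformly over
non-degenerate pair systems Ψ with ‖Ψ‖_N ≤ L and convex K ⊆ [−N,N]: |𝔠_Ψ| ≤ K_L(1+|𝔖_Ψ|) and
|Σ_{n∈K}Λ(ψ₁(n))Λ(ψ₂(n)) − β_∞𝔖_Ψ − 𝔠_Ψ·Σ_{n∈K}λ(ψ₁(n))λ(ψ₂(n))| ≤ ε(1+|𝔖_Ψ|)N, where 𝔠_Ψ = lim_y
Σ_{k,l,b,d≤y} μ(k)μ(l)λ(b)λ(d) log b log d·dens_Ψ(k²b, l²d) is the Liouville cofactor constant (an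
Euler product ζ(2)²∏_pH_p(Ψ); for (n, n+2): (3/2)ζ(2) by the local computation in NOTES). The
route's own claim: the Hardy–Littlewood error of a pair system IS its Chowla sum times an explicit
non-zero constant. [difficulty: open-problem] (why it might fail: rests on RelativeChowlaLevel
(Siegel-complete) plus bookkeeping: the BV main terms must reassemble to 𝔖_Ψ with the (b,d)-cut, and
the λ-signed double series must converge along {lcm ≤ y}; a local-factor slip changes 𝔠_Ψ, a
non-convergence makes limUnder junk.) [MurtyVatwani2017, Vatwani2016, DukeFriedlanderIwaniec1997,
TaoFMP2016, Polymath8b2014]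
#3 RelativeChowlaLevel (crux) — RELATIVE level of distribution of the pair Chowla sequence c_Ψ(n) =
λ(ψ₁(n))λ(ψ₂(n)): for every δ > 0 and A, Σ_{q ≤ N^{1−δ}} max_r sup_{[u,v]⊆[−N,N]} |Σ_{n∈[u,v], n≡r
(q)} c_Ψ(n) − (1/q)Σ_{n∈[u,v]} c_Ψ(n)| ≤ C·N/(log N)^A, uniformly over non-degenerate pair systems
with ‖Ψ‖_N ≤ L. Mean-free (a biased i.i.d. sequence passes it; the Liouville-propagated bias pattern
β_{(a₁,a₂)} = λ(a₁)λ(a₂)β₀ is consistent with all dilation identities), hence parity-neutral;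
Elliott–Halberstam-shaped, level N^{1−δ₁} with δ₁ = DFI's saving would suffice. [difficulty:
open-problem] (why it might fail: Siegel-complete: in the illusory world λ≈χ makes c(n)≈χ(r(r+h))
constant-sign on classes mod q_exc ≤ N^{1−δ}; at small primes it is Tao's entropy-decrement
independence, known only log-averaged for most p ≤ log^{O(1)}N; open at every level.) [TaoFMP2016,
TaoTeravainenDuke2019, TaoTeravainen2021, MatomakiRadziwillTao2015, MurtyVatwani2017]
#4 ChowlaNatural (crux) — two-point Chowla–Elliott for λ along PAIRS OF AFFINE FORMS at natural
density, uniform over non-degenerate systems with ‖Ψ‖_N ≤ L and convex K ⊆ [−N,N]: |Σ_{n∈K∩ℤ}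
λ(ψ₁(n))λ(ψ₂(n))| ≤ εN for N ≥ N₀(L,ε). The route's ENTIRE parity input (it fails for the Liouville
ghost by design); its logarithmically averaged fixed-system form is Tao's theorem, its odd-order
analogues hold at natural density. [difficulty: open-problem] (why it might fail: natural-density
two-point Chowla is open (Tao 2016 is log-averaged; removing the average is blocked for soft
reasons, Literature.Barriers.Parity.LogarithmicAveraging); shift-uniformity |b_i| ≤ LN makes it
Siegel-complete (λ(n)λ(n+q_exc) biased).) [TaoFMP2016, TaoTeravainenDuke2019, HelfgottRadziwill2021,
Pilatte2026, MatomakiRadziwillTao2015, Chowla1965]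
#5 RelativePairsToGHL (crux) — DECLARED RESIDUAL (complementary sector, not addressed by this
mechanism and staffed last): relative Dickson for pairs implies the generalised Hardy–Littlewood
conjecture in full, i.e. (RelativePairs → DimOne: Dickson–Hardy–Littlewood at d = 1 for every t with
absolute error εN — higher-order parity for t ≥ 3 and the absolute upgrade on systems with ∏β_p ≍
(log log N)) composed with the tree's PROVED fibration lemma
FibrationGlue.generalizedHardyLittlewood_of_dimOne : DimOne → GeneralizedHardyLittlewood
(Theorems/LeeYangFibresFibrationLemmaFinal.lean), which the residual's prover imports in a Theorems
file — never in this route file (cone repair rev 1: it replaces RelativePairsToDimOne at the same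
strength given the tree). The same opening at truncation N^θ, tθ < ½, reduces the d = 1 part to
k-point ChowlaNatural + RelativeChowlaLevel_k + multilinear Kloosterman cores with λ-coefficients
(shared in kind with DeterminantMoebiusCores.HigherCores) — not filed now. [deps: RelativePairs]
[difficulty: open-problem] (why it might fail: contains prime k-tuple parity for k ≥ 3 (k-point
Chowla) and the absolute upgrade; Siegel content already sits in RelativePairs, so no Siegel-based
refutation, but it is GHL-hard as typed.) [GreenTao2010, Dickson1904, LichtmanTeravainen2022]
#9 LawOfLevel (support) — RelativeChowlaLevel ⇒ PairLiouvilleLaw (XL, provable modulo bookkeeping):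
exact Liouville opening S_Ψ = MAIN + CORE (checked numerically to 10⁻¹² in the planner's
compute/identity_check.py); MAIN by Bombieri–Vinogradov for Λ in progressions to moduli ≤
L·N^{1/2−ε} (tree: BombieriVinogradovStatement_holds) plus Green–Tao App. A lattice counts and the
𝔖-reassembly; the balanced window of CORE by
DukeFriedlanderIwaniec1997_bilinearKloostermanFractions_holds (tree) with λ⊗λ coefficients; the rest
of CORE by RelativeChowlaLevel and SignedCofactorConstant. [difficulty: XL]
[DukeFriedlanderIwaniec1997, BettinChandee2018, GreenTao2010, MurtyVatwani2017]
#9 SignedCofactorConstant (support) — the signed cofactor series converges and its limit is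
uniformly bounded: for every L there is K_L such that for every non-degenerate pair system with
coefficients |a_i| ≤ L (shifts arbitrary), cofactorPartial Ψ y → liouvilleConstant Ψ and
|liouvilleConstant Ψ| ≤ K_L(1 + |𝔖_Ψ|) (prime number theorem for λ with the classical zero-free
region, twisted by the multiplicative density corrections; Euler product ζ(2)²∏_pH_p(Ψ)).
[difficulty: L] [MontgomeryVaughan2007, GreenTao2010]
DROPPED at the cone repair (rev 1): DimOne (the shared d = 1 node stmt-Parity-0819 of
DicksonFibration / DeterminantMoebiusCores / JordanCorner stays with those routes; here it was only
the codomain of the old residual RelativePairsToDimOne) while the Assembly item is restated over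
RelativePairsToGHL (D-0027: `closes` is the deciding theorem). NEEDS-FACT: NONE — no decl of the
route uses an unproved Literature fact (gate cone: 0 unproved among 27 project constants); the
unproved XL facts Literature.NumberTheory.Sieve.GreenTao2010_gowersUniformity /
GreenTao2010_transference (and GreenTao2010_wTrickedProduct_of_gowersUniformity) rode in only on
`import Summits.Parity.GeneralizedHardyLittlewood.Theorems.LeeYangFibresFibrationLemmaFinal` (chain
…FibrationLemmaDefs → Literature…LinearEquationsInPrimesMainReduction → …NormalFormExtension /
…CrudeBounds → …NormalForm → …Transference; also …FibreSums / …Lift → …WTrick → …MainReduction), now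
dropped; what remains in the module cone rides on the gate-written `import Summits.Parity.Statement`
and is shared by every route of the summit (0 droppable). Summit-wide root fix (Literature
maintenance, not a planner write): split …LinearEquationsInPrimesTransference.lean into its
vocabulary (local Gowers norm, wCutoff, vonMangoldtW) and a leaf holding the two named facts, or
point …NormalForm.lean at the vocabulary — that cleans the cone of every d = 1 route importing the
fibration lemma.

TWO-LAYER PLAN. LawOfLevel ⇐ CoreIdentity (the exact opening S_Ψ = MAIN + CORE with W-weights of
level N^{1/2+ε}, square-layer truncation at K₀ = (log N)^C) →
MainAndCentre (MAIN = β_∞𝔖_Ψ + o((1+𝔖_Ψ)N) by Bombieri–Vinogradov and lattice counts; balanced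
window of CORE = o(N) by DFI with λ⊗λ
coefficients, window width tied to the exponent 11/48) → LawOfLevel (RelativeChowlaLevel +
SignedCofactorConstant on the remaining (b,d)).
RelativePairsToGHL ⇐ (tenure, only after PairLiouvilleLaw closes) TupleLiouvilleLaw_t (opening at
N^θ, tθ < ½) → HigherChowlaNatural →
RelativeToAbsolute (→ DimOne, then the tree's fibration lemma). k ≤ 3 each, depth 1; nothing filed
now.

KILL CRITERIA. A PROVED counterexample to RelativeChowlaLevel (a pair system, a level N^{1−δ} and
residues where the class sums provably deviate from the mean
share) kills LawOfLevel and forces the pivot "restate relative to character modes of conductor ≤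
(log N)^C" (the Siegel-robust form) or closes
the route `refuted:RelativeChowlaLevel` if the witness is not of exceptional-character type. A proof
that 𝔠_Ψ = 0 for some admissible Ψ, or
that cofactorPartial diverges, refutes PairLiouvilleLaw as typed (misstated) — repair by the
corrected constant. ¬ChowlaNatural at a fixed
system refutes the parity input of every route and decides nothing here; DimOne proved elsewhere
moots the route (close superseded).

NOT DECOMPOSED YET. The t ≥ 3 sector (RelativePairsToGHL) and the absolute upgrade; the exact
admissible window width for DFI (function of 11/48 and the
square-layer cut K₀); the main-term identity 𝔖' = 𝔖_Ψ for the (b,d)-cut (a finite Euler-product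
computation, part of MainAndCentre); the
Siegel-robust restatement of RelativeChowlaLevel (class shares corrected by real characters of small
conductor); rates (none are claimed).

CHEAPEST FALSIFIER. (i) The local computation of 𝔠_Ψ: compute H_p(Ψ) for (n, n+2) at p = 2 and a
generic p and confirm 𝔠 ≠ 0 (planner: E_p = (p−1)/(p+1)
generic, E_2 = 1/2, giving 𝔠_2 = (3/2)ζ(2) — by hand, to be re-done by a refuter/CAS); (ii) the
exact identity S = MAIN + CORE and the
re-closing of MAIN into Λ-in-progressions: verified numerically at x = 2·10⁵
(compute/identity_check.py, errors 1e−12); (iii) consistency of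
RelativeChowlaLevel with the dilation identities C(x;p,0) = −C_{(m,pm+h)}(x/p): checked mod p and p²
(bias pattern λ(a₁)λ(a₂)β₀ consistent);
(iv) literature: does MurtyVatwani2018 ("A remark on a conjecture of Chowla", J. Ramanujan Math.
Soc. 33) already state the mean-free law? not
retrievable this session (APIs rate-limited) — a `known` there would downgrade crux 2 but not the
assembly.

NUMBERS. DFI saving: (M+N)^{11/48+ε}(MN)^{3/8} against trivial (MN)^{1/2} (tree statement), i.e.
M^{−1/48} at M = N; truncation B = N^{1/2+ε} with
ε < 1/200 keeps the balanced window inside DFI's range. Bombieri–Vinogradov level N^{1/2}(log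
N)^{−B} (tree). 𝔠_{(n,n+2)} = (3/2)ζ(2) ≈ 2.467
(planner's local computation); mean of W(n)W(n+2) at x = 2·10⁵, B = 823: 1.935 vs truncated series
1.928. Items at open: 9; after the cone repair (rev 1): 7 (target, 4 cruxes, 2 supports), route
imports down to the Statement's own Literature module.

DEFINITION REQUESTS. None. New defs ride in the route file (intLiouville, chowlaSumOn, chowlaSum,
chowlaSumMod, pairDensity, cofactorPartial, liouvilleConstant;
all elaborate in Sketch.lean). Wanted literature: MurtyVatwani2018 (J. Ramanujan Math. Soc. 33
(2018) 111–123) — lit want filed.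

Novelty: Searches (2026-08-16): `lit frontier Parity --since 2023` (60 rows; relevant:
LichtmanTeravainen2022-type averages, arXiv:2501.10962 variants of
Chowla, arXiv:2604.25177 trilinear Kloosterman fractions — none with a pair identity); `lit search
--hybrid "Möbius shifted primes"`, `"Vatwani
Chowla twin primes arithmetic progressions Liouville"` (local: Vatwani2016 thesis held, ch. 7 read
pp.152–179: CE(θ), Thm 7.1.2, CE†, CE*);
`lit galaxy search "remark on a conjecture of Chowla" --star all` (1 panama hit, a reference list),
`"Twin primes and the parity problem"`
(L–T 2022 pdf read pp.1–4), `--mode intelligent "Murty Vatwani Chowla Elliott-Halberstam twin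
primes"` (15 hits: TaoFMP2016, Murty's Zhang
survey, Krishnamoorthy 2025; no pair identity); crossref "A remark on a conjecture of Chowla Murty
Vatwani" (10 rows, not found); openalex/s2/
arxiv rate-limited (HTTP 429). lean search: liouville (Mathlib ArithmeticFunction.liouville),
ChowlaConjecture/liouvilleCorrelation (tree),
DukeFriedlanderIwaniec1997_bilinearKloostermanFractions_holds (tree, proved).
Nearest prior art found: MurtyVatwani2017 / Vatwani2016 ch.7 (CE(θ<½) — μ at shifted primes in
progressions with (log x)^{−2} savings — ⇒ twin
asymptotic; one factor opened, prime kept); TaoFMP2016 (log-averaged two-point Chowla–Elliott for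
affine pairs); Polymath8b2014 §8 (bilinear
axiom); route-Parity-DeterminantMoebiusCores (symmetric Möbius opening, Λ♯-cores with level and log
savings); MurtyVatwani2018 (title only,
unread:  [refs: 2501.10962, 2604.25177, LichtmanTeravainen2022, Vatwani2016, TaoFMP2016, MurtyVatwani2017]

Barriers (technique_class: liouville-opening, chowla-transfer, kloosterman): - technique_class: liouville-opening, chowla-transfer, kloosterman
- Literature.Barriers.Parity.SelbergParityBarrier: evaded — the parity input is ChowlaNatural, a
λ-correlation along the two forms, not Type-I data; the ghost weight 1−λ(ψ₁)λ(ψ₂) violates it by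
design.
- Literature.Barriers.Parity.PrimePairParity: evaded — the deduction is not weight-insertion
invariant: inserting ω flips the sign of the core term 𝔠_Ψ·Σλλ.
- Literature.Barriers.Parity.TrueComplexityBinary: evaded — no Gowers norm; complete
multiplicativity of λ is the lever (random sign patterns are not multiplicative).
- Literature.Barriers.Parity.CircleMethodBinaryBarrier: evaded — no minor-arc bounds; the balanced
window is a bilinear Kloosterman sum with λ⊗λ coefficients (DFI), the rest is arithmetic.
- Literature.Barriers.Parity.LogarithmicAveraging: it does not evade; the bet is that
natural-density two-point Chowla (crux 4) is the right and minimal open target — the route claims no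
soft transfer from the log-averaged theorem.
- Literature.Barriers.Parity.FordMaynardMinimalTypeII: not in its class — no Type-I/II lower-bound
sieve; the core is an identity, the Type-II-like window is DFI's theorem.
- Literature.Barriers.Parity.SiegelZeroTwinPrimes: declared — RelativeChowlaLevel and shift-uniform
ChowlaNatural are Siegel-complete (illusory world: λ≈χ_exc biases classes mod q_exc and the shift
q_exc); any proof bounds Siegel quality, as GHL must (tree: noSiegelZeros_of_relativeDimOne).
- Literature.Barriers

History (route lifecycle, newest last):
- 2026-08-16T17:35:37Z · rev 1: restated Assembly (stmt-Parity-16153) — cone repair (route-repair seat rrepair-Parity-LiouvilleOpening-65dd5b0e): drop `import …Theorems.LeeYangFibresFibrationLemmaFinal` (its module cone carries the (planner-rrepair-Parity-LiouvilleOpening-65dd5b0e-0)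
- 2026-08-16T17:35:37Z · rev 1: dropped RelativePairsToDimOne, DimOne — cone repair (route-repair seat rrepair-Parity-LiouvilleOpening-65dd5b0e): drop `import …Theorems.LeeYangFibresFibrationLemmaFinal` (its module cone carries the (planner-rrepair-Parity-LiouvilleOpening-65dd5b0e-0)
- 2026-08-24T09:56:16Z · DORMANT — reconciler: no traction for 6.7 d (last activity item-evidence-added at 2026-08-17T16:57:35Z); parked, not closed — `ledger route dormant route-Parity-Liouville (operator:999:1000249)

sub-problem: GeneralizedHardyLittlewood · status: dormant · opened planner-plan-novel-Parity-GeneralizedHardyLittl-03955878-c-v2-g2-0 2026-08-16T17:18:55Z · rev 1 · ledger route-Parity-LiouvilleOpening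
GENERATED by the gate from the ledger (D-0016/17). Provers cite these decls: `theorem foo : Summit.Parity.GeneralizedHardyLittlewood.Theses.LiouvilleOpening.<Decl> := …` in Summits/Parity/GeneralizedHardyLittlewood/Theorems/<Name>.lean.
-/

namespace Summit.Parity.GeneralizedHardyLittlewood.Theses.LiouvilleOpening

open scoped BigOperators Topology Manifold Classical MeasureTheory ProbabilityTheory Matrix InnerProductSpace ComplexConjugate ContinuousMap
open Filter Set Function TopologicalSpace MeasureTheory

attribute [summit_statement] _root_.GeneralizedHardyLittlewood

/-- item stmt-Parity-16146 · target · rank 0 · open · by planner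
why it might fail: shift-uniform, hence Siegel-complete (a zero of unbounded quality at conductor q ≤ LN doubles the pair count at shift 2q, MatomakiMerikoski2023 Thm 1.3); contains binary Goldbach asymptotics for every large even M.
sources: GreenTao2010, MatomakiMerikoski2023, HardyLittlewood1923
[target] relative Dickson–Hardy–Littlewood for PAIRS: uniformly over non-degenerate d = 1 systems of
two forms with ‖Ψ‖_N ≤ L and convex K ⊆ [−N,N], |Σ_{n∈K}Λ(ψ₁(n))Λ(ψ₂(n)) − β_∞∏_pβ_p| ≤ ε(1 +
|∏_pβ_p|)N. Derived in glue.lean from PairLiouvilleLaw ∧ ChowlaNatural (theorem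
relativePairs_of_law); contains every fixed pair system's Hardy–Littlewood asymptotic (twins, Sophie
Germain, Goldbach shapes) and is shift-uniform. -/
@[route_item "route-Parity-LiouvilleOpening"]
def RelativePairs : Prop :=
  ∀ (L : ℕ) (ε : ℝ), 0 < ε → ∃ N₀ : ℕ, ∀ N : ℕ, N₀ ≤ N → ∀ Ψ : Fin 2 → Literature.NumberTheory.Sieve.AffLinForm 1, Literature.NumberTheory.Sieve.IsNondegenerateSystem Ψ → Literature.NumberTheory.Sieve.affLinSize Ψ N ≤ L → ∀ K : Set (Fin 1 → ℝ), Convex ℝ K → K ⊆ Literature.NumberTheory.Sieve.realBox 1 N → |Literature.NumberTheory.Sieve.vonMangoldtSum Ψ K N - Literature.NumberTheory.Sieve.archFactor Ψ K * Literature.NumberTheory.Sieve.singularProduct Ψ| ≤ ε * (1 + |Literature.NumberTheory.Sieve.singularProduct Ψ|) * (N : ℝ)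

/-- item stmt-Parity-16147 · crux · rank 2 · open · by planner
why it might fail: rests on RelativeChowlaLevel (Siegel-complete) plus bookkeeping: the BV main terms must reassemble to 𝔖_Ψ with the (b,d)-cut, and the λ-signed double series must converge along {lcm ≤ y}; a local-factor slip changes 𝔠_Ψ, a non-convergence makes limUnder junk.
sources: MurtyVatwani2017, Vatwani2016, DukeFriedlanderIwaniec1997, TaoFMP2016, Polymath8b2014
[crux] PAIR LIOUVILLE LAW: for every L there is K_L with, uniformly over non-degenerate pair systems
Ψ with ‖Ψ‖_N ≤ L and convex K ⊆ [−N,N]: |𝔠_Ψ| ≤ K_L(1+|𝔖_Ψ|) and |Σ_{n∈K}Λ(ψ₁(n))Λ(ψ₂(n)) − β_∞𝔖_Ψ −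
𝔠_Ψ·Σ_{n∈K}λ(ψ₁(n))λ(ψ₂(n))| ≤ ε(1+|𝔖_Ψ|)N, where 𝔠_Ψ = lim_y Σ_{k,l,b,d≤y} μ(k)μ(l)λ(b)λ(d) log b
log d·dens_Ψ(k²b, l²d) is the Liouville cofactor constant (an Euler product ζ(2)²∏_pH_p(Ψ); for (n,
n+2): (3/2)ζ(2) by the local computation in NOTES). The route's own claim: the Hardy–Littlewood
error of a pair system IS its Chowla sum times an explicit non-zero constant. [difficulty:
open-problem] -/
@[route_item "route-Parity-LiouvilleOpening", crux]
def PairLiouvilleLaw : Prop :=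
  ∀ L : ℕ, ∃ Kc : ℝ, ∀ ε : ℝ, 0 < ε → ∃ N₀ : ℕ, ∀ N : ℕ, N₀ ≤ N → ∀ Ψ : Fin 2 → Literature.NumberTheory.Sieve.AffLinForm 1, Literature.NumberTheory.Sieve.IsNondegenerateSystem Ψ → Literature.NumberTheory.Sieve.affLinSize Ψ N ≤ L → |(Filter.limUnder Filter.atTop (fun y : ℕ => ∑ k ∈ Finset.Icc 1 y, ∑ l ∈ Finset.Icc 1 y, ∑ b ∈ Finset.Icc 1 y, ∑ d ∈ Finset.Icc 1 y, (ArithmeticFunction.moebius k : ℝ) * (ArithmeticFunction.moebius l : ℝ) * (ArithmeticFunction.liouville b : ℝ) * (ArithmeticFunction.liouville d : ℝ) * Real.log b * Real.log d * ((((Finset.range ((k ^ 2 * b) * (l ^ 2 * d))).filter fun r : ℕ => ((k ^ 2 * b : ℕ) : ℤ) ∣ (Ψ 0).eval (fun _ => (r : ℤ)) ∧ ((l ^ 2 * d : ℕ) : ℤ) ∣ (Ψ 1).eval (fun _ => (r : ℤ))).card : ℝ) / (((k ^ 2 * b) * (l ^ 2 * d) : ℕ) : ℝ))))| ≤ Kc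 * (1 + |Literature.NumberTheory.Sieve.singularProduct Ψ|) ∧ ∀ K : Set (Fin 1 → ℝ), Convex ℝ K → K ⊆ Literature.NumberTheory.Sieve.realBox 1 N → |Literature.NumberTheory.Sieve.vonMangoldtSum Ψ K N - Literature.NumberTheory.Sieve.archFactor Ψ K * Literature.NumberTheory.Sieve.singularProduct Ψ - (Filter.limUnder Filter.atTop (fun y : ℕ => ∑ k ∈ Finset.Icc 1 y, ∑ l ∈ Finset.Icc 1 y, ∑ b ∈ Finset.Icc 1 y, ∑ d ∈ Finset.Icc 1 y, (ArithmeticFunction.moebius k : ℝ) * (ArithmeticFunction.moebius l : ℝ) * (ArithmeticFunction.liouville b : ℝ) * (ArithmeticFunction.liouville d : ℝ) * Real.log b * Real.log d * ((((Finset.range ((k ^ 2 * b) * (l ^ 2 * d))).filter fun r : ℕ => ((k ^ 2 * b : ℕ) : ℤ) ∣ (Ψ 0).eval (fun _ => (r : ℤ)) ∧ ((l ^ 2 * d : ℕ) : ℤ) ∣ (Ψ 1).eval (fun _ => (r : ℤ))).card : ℝ) / (((k ^ 2 * b) * (l ^ 2 * d) : ℕ) : ℝ)))) * (∑ n ∈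 @Finset.filter (Fin 1 → ℤ) (fun n => Literature.NumberTheory.Sieve.realPoint n ∈ K) (Classical.decPred _) (Literature.NumberTheory.Sieve.latticeBox 1 N), ∏ i, ((ArithmeticFunction.liouville (Int.toNat ((Ψ i).eval n)) : ℤ) : ℝ))| ≤ ε * (1 + |Literature.NumberTheory.Sieve.singularProduct Ψ|) * (N : ℝ)

/-- item stmt-Parity-16148 · crux · rank 3 · open · by planner
why it might fail: Siegel-complete: in the illusory world λ≈χ makes c(n)≈χ(r(r+h)) constant-sign on classes mod q_exc ≤ N^{1−δ}; at small primes it is Tao's entropy-decrement independence, known only log-averaged for most p ≤ log^{O(1)}N; open at every level.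
sources: TaoFMP2016, TaoTeravainenDuke2019, TaoTeravainen2021, MatomakiRadziwillTao2015, MurtyVatwani2017
[crux] RELATIVE level of distribution of the pair Chowla sequence c_Ψ(n) = λ(ψ₁(n))λ(ψ₂(n)): for
every δ > 0 and A, Σ_{q ≤ N^{1−δ}} max_r sup_{[u,v]⊆[−N,N]} |Σ_{n∈[u,v], n≡r (q)} c_Ψ(n) −
(1/q)Σ_{n∈[u,v]} c_Ψ(n)| ≤ C·N/(log N)^A, uniformly over non-degenerate pair systems with ‖Ψ‖_N ≤ L.
Mean-free (a biased i.i.d. sequence passes it; the Liouville-propagated bias pattern β_{(a₁,a₂)} =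
λ(a₁)λ(a₂)β₀ is consistent with all dilation identities), hence parity-neutral;
Elliott–Halberstam-shaped, level N^{1−δ₁} with δ₁ = DFI's saving would suffice. [difficulty:
open-problem] -/
@[route_item "route-Parity-LiouvilleOpening"]
def RelativeChowlaLevel : Prop :=
  ∀ (L : ℕ) (δ A : ℝ), 0 < δ → 0 < A → ∃ (C : ℝ) (N₀ : ℕ), ∀ N : ℕ, N₀ ≤ N → ∀ Ψ : Fin 2 → Literature.NumberTheory.Sieve.AffLinForm 1, Literature.NumberTheory.Sieve.IsNondegenerateSystem Ψ → Literature.NumberTheory.Sieve.affLinSize Ψ N ≤ L → ∀ u v : ℤ, -(N : ℤ) ≤ u → v ≤ N → ∀ r : ℕ → ℤ, ∑ q ∈ Finset.Icc 1 ⌊(N : ℝ) ^ (1 - δ)⌋₊, |(∑ n ∈ (Finset.Icc u v).filter (fun n : ℤ => (q : ℤ) ∣ n - r q), ∏ i, ((ArithmeticFunction.liouville (Int.toNat ((Ψ i).eval fun _ => n)) : ℤ) : ℝ)) - (∑ n ∈ Finset.Icc u v, ∏ i, ((ArithmeticFunction.liouville (Int.toNat ((Ψ i).eval fun _ => n)) :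 ℤ) : ℝ)) / q| ≤ C * (N : ℝ) / Real.log N ^ A

/-- item stmt-Parity-16149 · crux · rank 4 · open · by planner
why it might fail: natural-density two-point Chowla is open (Tao 2016 is log-averaged; removing the average is blocked for soft reasons, Literature.Barriers.Parity.LogarithmicAveraging); shift-uniformity |b_i| ≤ LN makes it Siegel-complete (λ(n)λ(n+q_exc) biased).
sources: TaoFMP2016, TaoTeravainenDuke2019, HelfgottRadziwill2021, Pilatte2026, MatomakiRadziwillTao2015, Chowla1965
[crux] two-point Chowla–Elliott for λ along PAIRS OF AFFINE FORMS at natural density, uniform over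
non-degenerate systems with ‖Ψ‖_N ≤ L and convex K ⊆ [−N,N]: |Σ_{n∈K∩ℤ} λ(ψ₁(n))λ(ψ₂(n))| ≤ εN for N
≥ N₀(L,ε). The route's ENTIRE parity input (it fails for the Liouville ghost by design); its
logarithmically averaged fixed-system form is Tao's theorem, its odd-order analogues hold at natural
density. [difficulty: open-problem] -/
@[route_item "route-Parity-LiouvilleOpening", crux]
def ChowlaNatural : Prop :=
  ∀ (L : ℕ) (ε : ℝ), 0 < ε → ∃ N₀ : ℕ, ∀ N : ℕ, N₀ ≤ N → ∀ Ψ : Fin 2 → Literature.NumberTheory.Sieve.AffLinForm 1, Literature.NumberTheory.Sieve.IsNondegenerateSystem Ψ → Literature.NumberTheory.Sieve.affLinSize Ψ N ≤ L → ∀ K : Set (Fin 1 → ℝ), Convex ℝ K → K ⊆ Literature.NumberTheory.Sieve.realBox 1 N → |(∑ n ∈ @Finset.filter (Fin 1 → ℤ) (fun n => Literature.NumberTheory.Sieve.realPoint n ∈ K) (Classical.decPred _) (Literature.NumberTheory.Sieve.latticeBox 1 N), ∏ i, ((ArithmeticFunction.liouville (Int.toNat ((Ψ i).eval n)) : ℤ)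 : ℝ))| ≤ ε * (N : ℝ)

/-- item stmt-Parity-15917 · crux · rank 5 · open · by planner
why it might fail: contains prime k-tuple parity for k ≥ 3 (k-point Chowla at natural density) and the absolute εN upgrade; GHL-hard as typed — it is the declared residual; no Siegel-based refutation (that content already sits in RelativePairs).
sources: GreenTao2010, Dickson1904, LichtmanTeravainen2022
[crux] DECLARED RESIDUAL (complementary sector, not addressed by this mechanism and staffed last):
relative Dickson–Hardy–Littlewood for PAIRS implies the generalised Hardy–Littlewood conjecture in
full — content = (RelativePairs → DimOne: Dickson–Hardy–Littlewood at d = 1 for every t with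
absolute error εN, i.e. higher-order parity for t ≥ 3 and the absolute upgrade on systems with ∏β_p
≍ log log N) composed with the tree's PROVED fibration lemma
`Summit.Parity.GeneralizedHardyLittlewood.Theorems.FibrationGlue.generalizedHardyLittlewood_of_dimOne
: DimOne → GeneralizedHardyLittlewood` (Theorems/LeeYangFibresFibrationLemmaFinal.lean) — a prover
imports that file in the Theorems proof, never in this route file (cone repair rev 1: it replaces
RelativePairsToDimOne at the same strength given the tree). The same opening at truncation N^θ, tθ <
½, reduces the d = 1 part to k-point ChowlaNatural + RelativeChowlaLevel_k + multilinear Kloosterman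
cores with λ-coefficients (shared in kind with DeterminantMoebiusCores.HigherCores) — not filed now.
[deps: RelativePairs] [difficulty: open-problem] -/
@[route_item "route-Parity-LiouvilleOpening", crux]
def RelativePairsToGHL : Prop :=
  RelativePairs → _root_.GeneralizedHardyLittlewood

/-- item stmt-Parity-16151 · support · rank 9 · open · by planner
sources: DukeFriedlanderIwaniec1997, BettinChandee2018, GreenTao2010, MurtyVatwani2017
[support] RelativeChowlaLevel ⇒ PairLiouvilleLaw (XL, provable modulo bookkeeping): exact Liouville
opening S_Ψ = MAIN + CORE (checked numerically to 10⁻¹² in the planner's compute/identity_check.py);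
MAIN by Bombieri–Vinogradov for Λ in progressions to moduli ≤ L·N^{1/2−ε} (tree:
BombieriVinogradovStatement_holds) plus Green–Tao App. A lattice counts and the 𝔖-reassembly; the
balanced window of CORE by DukeFriedlanderIwaniec1997_bilinearKloostermanFractions_holds (tree) with
λ⊗λ coefficients; the rest of CORE by RelativeChowlaLevel and SignedCofactorConstant. [difficulty:
XL] -/
@[route_item "route-Parity-LiouvilleOpening"]
def LawOfLevel : Prop :=
  RelativeChowlaLevel → PairLiouvilleLaw

/-- item stmt-Parity-16152 · support · rank 9 · open · by planner
sources: MontgomeryVaughan2007, GreenTao2010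
[support] the signed cofactor series converges and its limit is uniformly bounded: for every L there
is K_L such that for every non-degenerate pair system with coefficients |a_i| ≤ L (shifts
arbitrary), cofactorPartial Ψ y → liouvilleConstant Ψ and |liouvilleConstant Ψ| ≤ K_L(1 + |𝔖_Ψ|)
(prime number theorem for λ with the classical zero-free region, twisted by the multiplicative
density corrections; Euler product ζ(2)²∏_pH_p(Ψ)). [difficulty: L] -/
@[route_item "route-Parity-LiouvilleOpening"]
def SignedCofactorConstant : Prop :=
  ∀ L : ℕ, ∃ Kc : ℝ, ∀ Ψ : Fin 2 → Literature.NumberTheory.Sieve.AffLinForm 1, Literature.NumberTheory.Sieve.IsNondegenerateSystem Ψ → (∀ i j, |(Ψ i).coeff j| ≤ (L : ℤ)) → Filter.Tendsto (fun y : ℕ => ∑ k ∈ Finset.Icc 1 y, ∑ l ∈ Finset.Icc 1 y, ∑ b ∈ Finset.Icc 1 y, ∑ d ∈ Finset.Icc 1 y, (ArithmeticFunction.moebius k : ℝ) * (ArithmeticFunction.moebius l : ℝ) * (ArithmeticFunction.liouville b : ℝ) * (ArithmeticFunction.liouville d : ℝ) * Real.log b * Real.log d * ((((Finset.range ((k ^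 2 * b) * (l ^ 2 * d))).filter fun r : ℕ => ((k ^ 2 * b : ℕ) : ℤ) ∣ (Ψ 0).eval (fun _ => (r : ℤ)) ∧ ((l ^ 2 * d : ℕ) : ℤ) ∣ (Ψ 1).eval (fun _ => (r : ℤ))).card : ℝ) / (((k ^ 2 * b) * (l ^ 2 * d) : ℕ) : ℝ))) Filter.atTop (nhds (Filter.limUnder Filter.atTop (fun y : ℕ => ∑ k ∈ Finset.Icc 1 y, ∑ l ∈ Finset.Icc 1 y, ∑ b ∈ Finset.Icc 1 y, ∑ d ∈ Finset.Icc 1 y, (ArithmeticFunction.moebius k : ℝ) * (ArithmeticFunction.moebius l : ℝ) * (ArithmeticFunction.liouville b : ℝ) * (ArithmeticFunction.liouville d : ℝ) * Real.log b * Real.log d * ((((Finset.range ((k ^ 2 * b) * (l ^ 2 * d))).filter fun r : ℕ => ((k ^ 2 * b : ℕ) : ℤ) ∣ (Ψ 0).eval (fun _ => (r : ℤ)) ∧ ((l ^ 2 * d : ℕ) : ℤ) ∣ (Ψ 1).eval (fun _ => (r : ℤ))).card : ℝ) / (((k ^ 2 * b) * (l ^ 2 * d) : ℕ) : ℝ)))))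 ∧ |(Filter.limUnder Filter.atTop (fun y : ℕ => ∑ k ∈ Finset.Icc 1 y, ∑ l ∈ Finset.Icc 1 y, ∑ b ∈ Finset.Icc 1 y, ∑ d ∈ Finset.Icc 1 y, (ArithmeticFunction.moebius k : ℝ) * (ArithmeticFunction.moebius l : ℝ) * (ArithmeticFunction.liouville b : ℝ) * (ArithmeticFunction.liouville d : ℝ) * Real.log b * Real.log d * ((((Finset.range ((k ^ 2 * b) * (l ^ 2 * d))).filter fun r : ℕ => ((k ^ 2 * b : ℕ) : ℤ) ∣ (Ψ 0).eval (fun _ => (r : ℤ)) ∧ ((l ^ 2 * d : ℕ) : ℤ) ∣ (Ψ 1).eval (fun _ => (r : ℤ))).card : ℝ) / (((k ^ 2 * b) * (l ^ 2 * d) : ℕ) : ℝ))))| ≤ Kc * (1 + |Literature.NumberTheory.Sieve.singularProduct Ψ|)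

-- earlier Assembly (stmt-Parity-16153, replaced 2026-08-16T17:35:37Z -> stmt-Parity-15916): retired by None — PairLiouvilleLaw → ChowlaNatural → RelativePairsToDimOne → _root_.GeneralizedHardyLittlewood
/-- item stmt-Parity-15916 · assembly · rank 1 · open · by planner
sources: GreenTao2010
[assembly] PairLiouvilleLaw → ChowlaNatural → RelativePairsToGHL → GeneralizedHardyLittlewood (the
type of `closes`; cone repair rev 1: RelativePairsToGHL replaces RelativePairsToDimOne, no Theorems
import). -/
@[route_item "route-Parity-LiouvilleOpening"]
def Assembly : Prop :=
  PairLiouvilleLaw → ChowlaNatural → RelativePairsToGHL → _root_.GeneralizedHardyLittlewood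

/-! D-0027 §2.1 — DECIDING THEOREM (planner-authored via `route open/edit --closes-file`; by planner-rrepair-Parity-LiouvilleOpening-65dd5b0e-0 2026-08-16T17:35:37Z):
its hypotheses are this route's items and its conclusion the sub-problem Statement (glue_lint), and it elaborates with this file. -/

@[closes "route-Parity-LiouvilleOpening"] theorem closes (hLaw : PairLiouvilleLaw) (hCh : ChowlaNatural) (hRes : RelativePairsToGHL) :
    _root_.GeneralizedHardyLittlewood := by
  have key : ∀ (S c C s N ε K' : ℝ), 0 ≤ s → 0 ≤ N → 0 < ε → 0 ≤ K' →
      |c| ≤ K' * (1 + s) → |S - c * C| ≤ ε / 2 * (1 + s) * N →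
      |C| ≤ ε / (2 * (K' + 1)) * N → |S| ≤ ε * (1 + s) * N := by
    intro S c C s N ε K' hs hN hε hK' hc h1 h2
    have htri : |S| ≤ |S - c * C| + |c| * |C| := by
      calc |S| = |(S - c * C) + c * C| := by ring_nf
        _ ≤ |S - c * C| + |c * C| := abs_add_le _ _
        _ = |S - c * C| + |c| * |C| := by rw [abs_mul]
    have hcC : |c| * |C| ≤ K' * (1 + s) * (ε / (2 * (K' + 1)) * N) :=
      mul_le_mul hc h2 (abs_nonneg _) (by positivity)
    have hK1 : K' / (K' + 1) ≤ 1 := by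
      rw [div_le_one (by positivity)]; linarith
    calc |S| ≤ |S - c * C| + |c| * |C| := htri
      _ ≤ ε / 2 * (1 + s) * N + K' * (1 + s) * (ε / (2 * (K' + 1)) * N) := add_le_add h1 hcC
      _ = ε / 2 * (1 + s) * N + (K' / (K' + 1)) * (ε / 2 * (1 + s) * N) := by
          field_simp
      _ ≤ ε / 2 * (1 + s) * N + 1 * (ε / 2 * (1 + s) * N) := by
          gcongr
      _ = ε * (1 + s) * N := by ring
  have hRP : RelativePairs := by
    intro L ε hε
    obtain ⟨Kc, hK⟩ := hLaw L
    set K' : ℝ := max Kc 0 with hK'def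
    have hK'0 : 0 ≤ K' := le_max_right _ _
    have hKle : Kc ≤ K' := le_max_left _ _
    obtain ⟨N₁, hN₁⟩ := hK (ε / 2) (by positivity)
    obtain ⟨N₂, hN₂⟩ := hCh L (ε / (2 * (K' + 1))) (by positivity)
    refine ⟨max N₁ N₂, fun N hN Ψ hΨ hL K hKc hKN => ?_⟩
    obtain ⟨hc, hlaw⟩ := hN₁ N (le_of_max_le_left hN) Ψ hΨ hL
    have h1 := hlaw K hKc hKN
    have h2 := hN₂ N (le_of_max_le_right hN) Ψ hΨ hL K hKc hKN
    set s := |Literature.NumberTheory.Sieve.singularProduct Ψ| with hsdef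
    have hs0 : 0 ≤ s := abs_nonneg _
    have hN0 : (0 : ℝ) ≤ N := Nat.cast_nonneg N
    have hc' := hc.trans
      (mul_le_mul_of_nonneg_right hKle (by positivity) : Kc * (1 + s) ≤ K' * (1 + s))
    exact key _ _ _ s N ε K' hs0 hN0 hε hK'0 hc' h1 h2
  exact hRes hRP

end Summit.Parity.GeneralizedHardyLittlewood.Theses.LiouvilleOpening
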